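import Mathlib
import Literature.NumberTheory.LFunctions.Zhang2022.Section10cMid1422Profile
import HarnessLib

/-!
# Zhang (2022) §10c: `Z22:§10.u049 (iii)` — the middle range of `S_j(𝐚₁₄,𝐚₂₂)` passes from its
# `n`-sum to the printed `z`-integral, `Typed.Sec10C.Mid1422Int c′`, PROVED OUTRIGHT

Topic `Literature/NumberTheory/LFunctions/Zhang2022` (Landau–Siegel audit tree; verdict-neutral).
Y. Zhang, *Discrete mean estimates and the Landau–Siegel zero*, arXiv:2211.02515v1 (2022)
[Zhang2022LandauSiegel], §10 p. 59 (tex L3028, the continued equality): "`… = (500𝔞/log P)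
∫_{0.496}^{0.498}(−1 − πij(z − 0.496))(ι₃𝔤𝔥_{j6}(0.498 − z)/0.498 + ι₄𝔤𝔥_{j7}(0.5 − z)/0.5)dz + o(α)`"
— **an unrefereed manuscript under adjudication; this file proves ONE of its displayed steps from
tree theorems and asserts nothing about its Theorems 1–2.** ZHANG-L discharge lane (WP10, seat
zl-w10-p5), following the template of sz-d34's `Section10cTop1422Int` (D-0069, layer L3); closes the
§10c node `Mid1422Int` feeding the v19 leaf `Typed.Sec10C.Gather1422` via `gather1422_of_ranges`
(with `top1422Int_holds`, `mid1422Eval_of_rel`, `top1422Eval_of_rel`: only `Low1422Small` — an edge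
from the absolute Lemma 8.4 so far — and `Lemma84Rel` then stand between the tree and `Gather1422`).

`mid1422Int_holds : Mid1422Int c′` — no manuscript claim enters as a hypothesis. Route: the §8
evaluation rule `lamAvg_rule` (`Section10cLamAvgRule`: `λ₀ⱼ(n) = (φ(n)/n)²(1 + O(α𝓛))` and
`Σ_{n<x}|χ(n)|φ(n)/n² = c_D log x + O(𝓛²)` + partial summation) applied to the profile
`G(t) = (−1 + β_j log(P^{0.496}/t))(ι₃𝔤_{j6}(P^{0.498}/t)/0.498 + ι₄𝔤_{j7}(P^{0.5}/t)/0.5)` on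
`[P^{0.496}, P^{0.498}]` (`Section10cMid1422Profile`: `midG1422_bounds`, `midSum1422_eq`); the
substitution `t = P^z` (`Section10MainTerms.integral_Ppow_Ppow`); the comparison at `P^z` with the
printed integrand (`midG1422_at_rpow`); and `c_D·L′(1,χ)² = 𝔞` (`midInt1422_eq`). Total error
`≤ C(c′)·𝓛⁻¹² ≤ εα` for `𝓛 ≥ C(c′)/(επ) + 1`.

## References

* Y. Zhang, arXiv:2211.02515v1 (2022), §10 p. 59; §8 p. 48–49; §2 (2.13), (2.26), (2.31).
  [cite: Zhang2022LandauSiegel, §10 p. 59]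
-/

noncomputable section

open Complex Real ComplexConjugate
open Literature.NumberTheory.LFunctions.Zhang2022.Skeleton

namespace Literature.NumberTheory.LFunctions.Zhang2022.Typed.Sec10C

section Mid1422

/-- Arithmetic of the integrated `P^z`-comparison. [folklore] -/
private theorem arith_cmp {cD Cz ℓ X : ℝ} (hcD0 : 0 ≤ cD) (hcD1 : cD ≤ 1) (hℓ : 0 < ℓ) (hCz : 0 ≤ Cz)
    (hX : X ≤ Cz * (ℓ ^ 8)⁻¹ * 0.002) : cD * ℓ ^ 9 * X ≤ 0.002 * Cz * ℓ := by
  have hX0 : cD * ℓ ^ 9 * X ≤ 1 * ℓ ^ 9 * (Cz * (ℓ ^ 8)⁻¹ * 0.002) := by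
    have h9 : 0 ≤ ℓ ^ 9 := by positivity
    rcases le_or_gt 0 X with hx | hx
    · exact mul_le_mul (mul_le_mul_of_nonneg_right hcD1 h9) hX hx (by positivity)
    · have : cD * ℓ ^ 9 * X ≤ 0 := by
        have : 0 ≤ cD * ℓ ^ 9 := by positivity
        nlinarith
      have : 0 ≤ 1 * ℓ ^ 9 * (Cz * (ℓ ^ 8)⁻¹ * 0.002) := by positivity
      linarith
  refine hX0.trans (le_of_eq ?_)
  field_simp

/-- Arithmetic of the final `o(α)` bound of `mid1422Int_holds`. [folklore] -/
private theorem arith_final {ℓ ε C₀ Mtot Cz nK nS K₀ : ℝ} (hℓ : 1 ≤ ℓ) (hε : 0 < ε) (hC₀ : 0 ≤ C₀)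
    (hMtot : 0 ≤ Mtot) (hCz : 0 ≤ Cz) (hnS0 : 0 ≤ nS) (hK₀ : 0 ≤ K₀)
    (hnK : nK ≤ K₀ * ℓ ^ 4 / ℓ ^ 18) (hnS : nS ≤ C₀ * ℓ ^ 2 * Mtot + 0.002 * Cz * ℓ)
    (hbig : K₀ * (C₀ * Mtot + 0.002 * Cz) / (ε * π) + 1 ≤ ℓ) :
    nK * nS ≤ ε * (π / ℓ ^ 9) := by
  have hℓ0 : 0 < ℓ := by linarith
  set Ctot : ℝ := K₀ * (C₀ * Mtot + 0.002 * Cz) with hCtot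
  have hCtot0 : 0 ≤ Ctot := by positivity
  have hS' : nS ≤ (C₀ * Mtot + 0.002 * Cz) * ℓ ^ 2 := by
    have : ℓ ≤ ℓ ^ 2 := by nlinarith
    nlinarith
  have h1 : nK * nS ≤ Ctot * (ℓ ^ 4 * ℓ ^ 2 / ℓ ^ 18) := by
    calc nK * nS ≤ (K₀ * ℓ ^ 4 / ℓ ^ 18) * ((C₀ * Mtot + 0.002 * Cz) * ℓ ^ 2) :=
          mul_le_mul hnK hS' hnS0 (by positivity)
      _ = Ctot * (ℓ ^ 4 * ℓ ^ 2 / ℓ ^ 18) := by rw [hCtot]; ring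
  have h2 : Ctot * (ℓ ^ 4 * ℓ ^ 2 / ℓ ^ 18) = Ctot / ℓ ^ 3 / ℓ ^ 9 := by
    field_simp
  have hεπ : 0 < ε * π := by positivity
  have h3 : Ctot ≤ ε * π * ℓ ^ 3 := by
    have h4 : Ctot / (ε * π) ≤ ℓ := by linarith
    rw [div_le_iff₀ hεπ] at h4
    have h5 : ℓ ≤ ℓ ^ 3 := by nlinarith
    nlinarith
  rw [h2] at h1
  refine h1.trans ?_
  rw [div_div, div_le_iff₀ (by positivity)]
  calc Ctot ≤ ε * π * ℓ ^ 3 := h3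
    _ = ε * (π / ℓ ^ 9) * (ℓ ^ 3 * ℓ ^ 9) := by field_simp

set_option maxHeartbeats 400000 in
/-- **Z22:§10.u049 (iii) holds** [Z22 p.59, tex L3028, the continued equality]: `Mid1422Int c′` —
"`… = (500𝔞/log P)∫_{0.496}^{0.498}(−1 − πij(z − 0.496))(ι₃𝔤𝔥_{j6}(0.498 − z)/0.498 +
ι₄𝔤𝔥_{j7}(0.5 − z)/0.5)dz + o(α)`" for the arithmetic form `midSum1422` of the middle range of
`S_j(𝐚₁₄,𝐚₂₂)`. PROVED OUTRIGHT (no manuscript claim as hypothesis): the §8 evaluation rule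
(`lamAvg_rule`), the substitution `t = P^z`, the shift comparison `β_j log P = jπi + O(𝓛⁻⁸)` and
sz-d19's `𝔤_{jμ}(P^w) = 𝔤𝔥_{jμ}(w) + O(𝓛⁻⁸)` (`μ = 6, 7`), and `c_D·L′(1,χ)² = 𝔞`; the total error
is `≪_{c′} 𝓛⁻¹² = o(α)`. [cite: Zhang2022LandauSiegel, §10 p. 59] -/
theorem mid1422Int_holds (c' : ℝ) : Mid1422Int c' := by
  intro ε hε
  obtain ⟨C₀, hC₀, hrule⟩ := lamAvg_rule c'
  -- the constants
  obtain ⟨Cp, hCp⟩ : ∃ Cp : ℝ, Cp = 75 * |c'| * π ^ 2 + 40 * |c'| ^ 2 * π ^ 3 := ⟨_, rfl⟩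
  obtain ⟨Cz, hCz⟩ : ∃ Cz : ℝ, Cz = 7.2 * (0.03 * π ^ 2 * |c'| * (6 + Cp) + 1.03 * Cp) := ⟨_, rfl⟩
  obtain ⟨Kι, hKι⟩ : ∃ Kι : ℝ, Kι = ‖iota3 / (0.498 : ℂ)‖ + ‖iota4 / (0.5 : ℂ)‖ := ⟨_, rfl⟩
  obtain ⟨Mtot, hMtot⟩ : ∃ Mtot : ℝ,
      Mtot = (1 + 4 * π) * (146 * Kι) + (4 * (146 * Kι) + (1 + 4 * π) * (449 * Kι)) * π := ⟨_, rfl⟩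
  obtain ⟨K₀, hK₀⟩ : ∃ K₀ : ℝ, K₀ = 8000 * Real.exp 9 := ⟨_, rfl⟩
  obtain ⟨Ctot, hCtot⟩ : ∃ Ctot : ℝ, Ctot = K₀ * (C₀ * Mtot + 0.002 * Cz) := ⟨_, rfl⟩
  have hCp0 : 0 ≤ Cp := by rw [hCp]; positivity
  have hCz0 : 0 ≤ Cz := by rw [hCz]; positivity
  have hKι0 : 0 ≤ Kι := by rw [hKι]; positivity
  have hMtot0 : 0 ≤ Mtot := by rw [hMtot]; positivity
  have hK₀0 : 0 ≤ K₀ := by rw [hK₀]; positivity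
  have hCtot0 : 0 ≤ Ctot := by rw [hCtot]; positivity
  have hbig : ForAllLarge fun D _ _ => Ctot / (ε * π) + 1 ≤ ell D := by
    refine ⟨⌈Real.exp (Ctot / (ε * π) + 1)⌉₊, fun D _ χ hD _ _ => ?_⟩
    have hexp : Real.exp (Ctot / (ε * π) + 1) ≤ D := le_trans (Nat.le_ceil _) (by exact_mod_cast hD)
    show Ctot / (ε * π) + 1 ≤ Real.log D
    exact (Real.le_log_iff_exp_le (lt_of_lt_of_le (Real.exp_pos _) hexp)).mpr hexp
  refine ((hrule.and (forAllLarge_five_c c')).and hbig).mono ?_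
  intro D _ χ hq hp ⟨⟨hR, hD3, hℓ6, hc5⟩, hℓbig⟩ _ j hj
  -- parameters
  have hD2 : 2 ≤ D := by omega
  have hℓ3 : 3 ≤ ell D := by linarith
  have hℓ1 : 1 ≤ ell D := by linarith
  have hℓ0 : 0 < ell D := by linarith
  have hΛ : Real.log (bigP D) = ell D ^ 9 := by rw [bigP, Real.log_exp]
  have hΛpos : 0 < Real.log (bigP D) := by rw [hΛ]; positivity
  have hΛ0 : (Real.log (bigP D) : ℂ) ≠ 0 := by exact_mod_cast hΛpos.ne'
  have hα : 0 < alpha D := alpha_pos hΛpos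
  have hαΛ : alpha D * Real.log (bigP D) = π := by rw [alpha, div_mul_cancel₀ _ hΛpos.ne']
  have hαeq : alpha D = π / ell D ^ 9 := by rw [alpha, hΛ]
  have hP0 : 0 < bigP D := Real.exp_pos _
  have hP1 : 1 ≤ bigP D := one_le_bigP D
  have h496 : 1 ≤ bigP D ^ (0.496 : ℝ) := Real.one_le_rpow hP1 (by norm_num)
  have h498 : 1 ≤ bigP D ^ (0.498 : ℝ) := Real.one_le_rpow hP1 (by norm_num)
  have hhi1 : 1 ≤ bigP D ^ (0.5 : ℝ) := Real.one_le_rpow hP1 (by norm_num)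
  have hlohi : bigP D ^ (0.496 : ℝ) ≤ bigP D ^ (0.498 : ℝ) :=
    Real.rpow_le_rpow_of_exponent_le hP1 (by norm_num)
  have h498_5 : bigP D ^ (0.498 : ℝ) ≤ bigP D ^ (0.5 : ℝ) :=
    Real.rpow_le_rpow_of_exponent_le hP1 (by norm_num)
  have hhiP5 : bigP D ^ (0.5 : ℝ) + 1 ≤ bigP D := by
    -- `√P + 1 ≤ P` since `√P ≥ 2` (`P = e^{𝓛⁹} ≥ e^{6⁹}`)
    have hsq : bigP D ^ (0.5 : ℝ) * bigP D ^ (0.5 : ℝ) = bigP D := by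
      rw [← Real.rpow_add hP0]; norm_num
    have h2 : 2 ≤ bigP D ^ (0.5 : ℝ) := by
      have h4 : (4 : ℝ) ≤ bigP D := by
        rw [bigP]
        have : (4 : ℝ) ≤ Real.exp 2 := by
          have h1 := Real.exp_one_gt_d9
          have h2 : Real.exp 2 = Real.exp 1 * Real.exp 1 := by rw [← Real.exp_add]; norm_num
          rw [h2]; nlinarith
        refine this.trans (Real.exp_le_exp.mpr ?_)
        calc (2 : ℝ) ≤ 6 ^ 9 := by norm_num
          _ ≤ ell D ^ 9 := pow_le_pow_left₀ (by norm_num) hℓ6 9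
      nlinarith [Real.rpow_nonneg hP0.le (0.5 : ℝ)]
    nlinarith [Real.rpow_nonneg hP0.le (0.5 : ℝ)]
  have hhiP : bigP D ^ (0.498 : ℝ) + 1 ≤ bigP D := by linarith
  have h5P : bigP D ^ (0.5 : ℝ) ≤ bigP D := by linarith
  have h498P : bigP D ^ (0.498 : ℝ) ≤ bigP D := by linarith
  have h496P : bigP D ^ (0.496 : ℝ) ≤ bigP D := by linarith
  -- the profile and its bounds
  obtain ⟨G, hGdef⟩ : ∃ G : ℝ → ℂ, G = fun u =>
      (-1 + 1 * (betaJ c' D j * (Real.log (bigP D ^ (0.496 : ℝ) / u) : ℂ))) *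
        (iota3 / 0.498 * frakgW c' D j 6 (bigP D ^ (0.498 : ℝ) / u) +
          iota4 / 0.5 * frakgW c' D j 7 (bigP D ^ (0.5 : ℝ) / u)) := ⟨_, rfl⟩
  obtain ⟨M, hM⟩ : ∃ M : ℝ, M = (1 + 4 * π) * (‖iota3 / (0.498 : ℂ)‖ * 146 + ‖iota4 / (0.5 : ℂ)‖ * 146) :=
    ⟨_, rfl⟩
  obtain ⟨M', hM'⟩ : ∃ M' : ℝ, M' = 4 * alpha D * (‖iota3 / (0.498 : ℂ)‖ * 146 + ‖iota4 / (0.5 : ℂ)‖ * 146) +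
      (1 + 4 * π) * (‖iota3 / (0.498 : ℂ)‖ * (449 * alpha D) + ‖iota4 / (0.5 : ℂ)‖ * (449 * alpha D)) :=
    ⟨_, rfl⟩
  have hM0 : 0 ≤ M := by rw [hM]; positivity
  have hGb : ∀ t, bigP D ^ (0.496 : ℝ) ≤ t → t ≤ bigP D ^ (0.498 : ℝ) + 1 →
      DifferentiableAt ℝ G t ∧ ‖G t‖ ≤ M ∧ ‖deriv G t‖ ≤ M' / t := by
    intro t h1 h2
    rw [hGdef, hM, hM']
    exact midG1422_bounds c' j hα hℓ0.le hc5 h496P h496 h498P h498 h5P hhi1 (le_trans h496 h1)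
      (le_trans h2 hhiP)
  have hA := hR j _ _ M M' G h496 hlohi hhiP hM0 hGb
  have hMM : M + M' * Real.log (bigP D) = Mtot := by
    rw [hMtot, hM', hM, hKι, ← hαΛ]; ring
  rw [hMM] at hA
  -- the substitution `t = P^z`
  obtain ⟨Λ, hΛdef⟩ : ∃ Λ : ℝ, Λ = Real.log (bigP D) := ⟨_, rfl⟩
  obtain ⟨Iz, hIz⟩ : ∃ Iz : ℝ → ℂ, Iz = fun z => (-1 - π * I * j * ((z - 0.496 : ℝ) : ℂ)) *
      (iota3 / 0.498 * ghJ6 j (0.498 - z) + iota4 / 0.5 * ghJ7 j (0.5 - z)) := ⟨_, rfl⟩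
  have hsub : ∫ t in bigP D ^ (0.496 : ℝ)..bigP D ^ (0.498 : ℝ), G t / t =
      (Λ : ℂ) * ∫ z in (0.496 : ℝ)..0.498, G (bigP D ^ z) := by
    rw [bigP_rpow_eq_Ppow D 0.496, bigP_rpow_eq_Ppow D 0.498, ← hΛdef,
      integral_Ppow_Ppow (by rw [hΛdef]; exact hΛpos.le)]
    congr 1
    refine intervalIntegral.integral_congr fun z _ => ?_
    simp only [bigP_rpow_eq_Ppow D z, ← hΛdef]
  -- pointwise comparison at `P^z` and the integrated form
  have hpt : ∀ z ∈ Set.uIoc (0.496 : ℝ) 0.498, ‖G (bigP D ^ z) - Iz z‖ ≤ Cz * (ell D ^ 8)⁻¹ := by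
    intro z hz
    rw [Set.uIoc_of_le (by norm_num), Set.mem_Ioc] at hz
    rw [hGdef, hIz, hCz, hCp]
    exact midG1422_at_rpow c' hD3 hΛpos hj hz.1.le hz.2
  have hGc : ContinuousOn (fun z : ℝ => G (bigP D ^ z)) (Set.uIcc (0.496 : ℝ) 0.498) := by
    intro z hz
    rw [Set.uIcc_of_le (by norm_num)] at hz
    have hzlo : bigP D ^ (0.496 : ℝ) ≤ bigP D ^ z := Real.rpow_le_rpow_of_exponent_le hP1 hz.1
    have hzhi : bigP D ^ z ≤ bigP D ^ (0.498 : ℝ) + 1 :=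
      le_trans (Real.rpow_le_rpow_of_exponent_le hP1 hz.2) (by linarith)
    exact ((hGb _ hzlo hzhi).1.continuousAt.comp (Real.continuousAt_const_rpow hP0.ne')).continuousWithinAt
  have hIc : Continuous Iz := by rw [hIz]; fun_prop
  have hdiff : ‖(∫ z in (0.496 : ℝ)..0.498, G (bigP D ^ z)) - ∫ z in (0.496 : ℝ)..0.498, Iz z‖ ≤
      Cz * (ell D ^ 8)⁻¹ * 0.002 := by
    rw [← intervalIntegral.integral_sub (hGc.intervalIntegrable) (hIc.intervalIntegrable _ _)]
    have h := intervalIntegral.norm_integral_le_of_norm_le_const hpt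
    rwa [show |(0.498 : ℝ) - 0.496| = 0.002 by norm_num [abs_of_pos]] at h
  -- the constants `K₁` and `𝔞 = c_D L′²`
  obtain ⟨cD, hcD⟩ : ∃ cD : ℝ, cD = 6 / π ^ 2 * ∏ q ∈ D.primeFactors, ((q : ℝ) / (q + 1)) :=
    ⟨_, rfl⟩
  obtain ⟨hcD0, hcD1⟩ : 0 ≤ cD ∧ cD ≤ 1 := by rw [hcD]; exact RangeAverage.frakcD_bounds D
  rw [← hcD] at hA
  obtain ⟨K₁, hK₁⟩ : ∃ K₁ : ℂ, K₁ = 500 * deriv χ.LFunction 1 ^ 2 / (Λ : ℂ) ^ 2 := ⟨_, rfl⟩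
  have hK₁n : ‖K₁‖ ≤ K₀ * ell D ^ 4 / ell D ^ 18 := by
    rw [hK₁, hΛdef, hK₀]; exact norm_K500_le χ hℓ3 hp
  -- `midSum = K₁·A`, `midInt = K₁·c_D·Λ·∫I`
  have hMid : midSum1422 c' χ j = K₁ * lamAvg c' χ j (bigP D ^ (0.496 : ℝ)) (bigP D ^ (0.498 : ℝ))
      (fun n => G n) := by
    rw [hK₁, hGdef, hΛdef]; exact midSum1422_eq c' χ j
  have hInt : midInt1422 χ j = K₁ * ((cD : ℂ) * ((Λ : ℂ) * ∫ z in (0.496 : ℝ)..0.498, Iz z)) := by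
    rw [hK₁, hcD, hΛdef, hIz]; exact midInt1422_eq χ hD2 hq hp hΛpos j
  -- assemble
  rw [hMid, hInt, ← mul_sub, norm_mul]
  have hin : lamAvg c' χ j (bigP D ^ (0.496 : ℝ)) (bigP D ^ (0.498 : ℝ)) (fun n => G n) -
      (cD : ℂ) * ((Λ : ℂ) * ∫ z in (0.496 : ℝ)..0.498, Iz z) =
      (lamAvg c' χ j (bigP D ^ (0.496 : ℝ)) (bigP D ^ (0.498 : ℝ)) (fun n => G n) -
        (cD : ℂ) * ∫ t in bigP D ^ (0.496 : ℝ)..bigP D ^ (0.498 : ℝ), G t / t) +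
      (cD : ℂ) * (Λ : ℂ) * ((∫ z in (0.496 : ℝ)..0.498, G (bigP D ^ z)) -
        ∫ z in (0.496 : ℝ)..0.498, Iz z) := by
    rw [hsub]; ring
  rw [hin]
  have hnorm2 : ‖(cD : ℂ) * (Λ : ℂ) * ((∫ z in (0.496 : ℝ)..0.498, G (bigP D ^ z)) -
      ∫ z in (0.496 : ℝ)..0.498, Iz z)‖ ≤ 0.002 * Cz * ell D := by
    have hΛ9 : Λ = ell D ^ 9 := by rw [hΛdef, hΛ]
    rw [norm_mul, norm_mul, Complex.norm_real, Complex.norm_real, Real.norm_of_nonneg hcD0, hΛ9,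
      Real.norm_of_nonneg (by positivity)]
    exact arith_cmp hcD0 hcD1 hℓ0 hCz0 hdiff
  have hsum : ‖(lamAvg c' χ j (bigP D ^ (0.496 : ℝ)) (bigP D ^ (0.498 : ℝ)) (fun n => G n) -
        (cD : ℂ) * ∫ t in bigP D ^ (0.496 : ℝ)..bigP D ^ (0.498 : ℝ), G t / t) +
      (cD : ℂ) * (Λ : ℂ) * ((∫ z in (0.496 : ℝ)..0.498, G (bigP D ^ z)) -
        ∫ z in (0.496 : ℝ)..0.498, Iz z)‖ ≤ C₀ * ell D ^ 2 * Mtot + 0.002 * Cz * ell D :=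
    (norm_add_le _ _).trans (add_le_add hA hnorm2)
  rw [hCtot] at hℓbig
  have hfin := arith_final (nK := ‖K₁‖) hℓ1 hε hC₀ hMtot0 hCz0 (norm_nonneg _) hK₀0 hK₁n
    hsum hℓbig
  rw [hαeq]
  exact hfin

variable (c' : ℝ) in
/-- `Mid1422Int` — `_holds` alias of `mid1422Int_holds` above under the fact's exact name, stated under the
prover's own binders as section variables (appended 2026-08-28, D-0026 bookkeeping: the proof term is the
existing theorem of this file; no statement, definition or attribute is edited; no new named fact; the
ledger's debt table listed the fact unproved). [cite: Zhang2022LandauSiegel, §10 p. 59] -/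
theorem _root_.Literature.NumberTheory.LFunctions.Zhang2022.Typed.Sec10C.Mid1422Int_holds :
    _root_.Literature.NumberTheory.LFunctions.Zhang2022.Typed.Sec10C.Mid1422Int c' :=
  _root_.Literature.NumberTheory.LFunctions.Zhang2022.Typed.Sec10C.mid1422Int_holds (c' := c')

end Mid1422

end Literature.NumberTheory.LFunctions.Zhang2022.Typed.Sec10C
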